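import Summits.BirchSwinnertonDyer.BirchSwinnertonDyer.Theorems.EisensteinPrimesKernelIsogenyCertificateType
import HarnessLib

/-!
# Crux 3 `MazurMCOnCellB` (stmt-BirchSwinnertonDyer-19033), line `twistback` v12 — the SQUARE CERTIFICATE for the parity of a kernel line:
# `cd·Ψ₂Sq = cn·G² + K·H` in `ℤ[X]` with `cn, cd > 0` and `(G, H) = 1` (list Bezout) ⇒ `Ψ₂Sq > 0` at every real root of the kernel polynomial `H`
# (the kernel points are REAL ⇒ the line is EVEN), for kernel polynomials of ANY degree

Width seat bsd-line-x2-p1-w5 (gen 6), cell `bsd-eis` (run/shared/lean/pub/bsd-eis/), 2026-08-29; `--supports stmt-BirchSwinnertonDyer-19033 --as helper`.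
THEOREMS ONLY (no `def`, no named fact, no `sorry`, no instance). Companion of this seat's `…EisensteinPrimesKernelIsogenyCertificateType` (§7 there handles a
QUADRATIC kernel polynomial by locating a rational `t₀` outside the roots). WHY: for a rational `p`-line `Φ` whose character `χ` has order `> 2` the kernel
polynomial `h` is irreducible of degree `(p−1)/2 ≥ 3` (`p = 7`: cubic/sextic `χ`, `h` cubic; `p = 13`: degree `6`), and the sign of `Ψ₂Sq` at its real roots is
certified ALGEBRAICALLY: at a kernel point `P = (x, y)`, `Ψ₂Sq(x) = (2y + a₁x + a₃)²`, and `2y + a₁x + a₃` lies in `ℚ(x)·√c` where `ℚ(√c)` (`c > 0` for an even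
line, `c = 1` when `χ` has odd order) is the quadratic subextension of `ℚ(P)/ℚ(x)`; so `Ψ₂Sq ≡ c·g² (mod h)` for some `g ∈ ℚ[X]`, found numerically and
verified exactly by this seat's `kernel7.py` (for the 7 cubic/sextic X2b-at-`7` classes `g` is LINEAR: the kernel points `P, 2P, 4P` are collinear since
`P + 2P + 4P = O`).

CONTENT. `eval_ofList_real` (bookkeeping `aeval r (ofList l : ℚ[X]) = (ofList l : ℝ[X]).eval r`); **`forall_real_root_pos_of_sq_cert`**: for a curve `W/ℚ` with
`b₂, b₄, b₆` equal to the integers `B2, B4, B6`, integer lists `H, G, K, A, B` and integers `cn, cd > 0`, `D ≠ 0` with the two LIST identities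
`cd·[B6, 2B4, B2, 4] = cn·G·G + K·H` and `A·G + B·H = [D]` (closed `Bool`s via `PolyCert.isZeroL`, meant for `decide`): `∀ r : ℝ, H(r) = 0 → 0 < Ψ₂Sq(r)` —
exactly the hypothesis `hpos` of `…KernelIsogenyCertificateType.not_gvPar_of_isogenyCert_of_forall_real_root_pos`.

HONEST FRAMING: elementary real algebra; nothing about any `L`-value, Selmer group, main conjecture or BSD is asserted; closes no stub; nothing is booked;
0 cells / labels / stubs / tiers move; no summit statement / Mazur MC / BSD is proved for any curve.

References: [GreenbergVatsal2000] Thm. (1.3) (parity of the kernel character); [SilvermanAEC2009] III.2.3 (`(2y + a₁x + a₃)² = 4x³ + b₂x² + 2b₄x + b₆`).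
-/

set_option autoImplicit false
-- `Summit.BirchSwinnertonDyer.BirchSwinnertonDyer.…`: the summit and its single sub-problem share a name.
set_option linter.dupNamespace false

noncomputable section

open Polynomial Literature.NumberTheory.EllipticCurves.PolyCert

namespace Summit.BirchSwinnertonDyer.BirchSwinnertonDyer.Theorems.EisensteinPrimesKernelIsogenyCertificateSquare

/-- Bookkeeping: evaluating the `ℚ`-polynomial `ofList l` at a real number is evaluating the `ℝ`-polynomial `ofList l`. [folklore] -/
theorem eval_ofList_real : ∀ (l : List ℤ) (r : ℝ), aeval r (ofList l : ℚ[X]) = (ofList l : ℝ[X]).eval r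
  | [], r => by simp
  | a :: l, r => by
      rw [ofList_cons, ofList_cons, map_add, map_mul, aeval_C, aeval_X, eval_add, eval_mul, eval_C, eval_X, eval_ofList_real l r,
        map_intCast]

/-- **The square certificate.** If `b₂, b₄, b₆` of `W/ℚ` are the integers `B2, B4, B6`, and integer lists `H, G, K, A, B`, integers `cn, cd > 0`, `D ≠ 0` satisfy
`cd·(4X³ + B2·X² + 2B4·X + B6) = cn·G² + K·H` and `A·G + B·H = D` (as lists), then `Ψ₂Sq(r) > 0` at every real root `r` of `H`: there `cd·Ψ₂Sq(r) = cn·G(r)²`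
and `G(r) ≠ 0` (else `D = A(r)G(r) + B(r)H(r) = 0`). [folklore] -/
theorem forall_real_root_pos_of_sq_cert (W : WeierstrassCurve ℚ) (H G K A B : List ℤ) (cn cd D B2 B4 B6 : ℤ)
    (hcn : 0 < cn) (hcd : 0 < cd) (hD : D ≠ 0) (hb₂ : W.b₂ = B2) (hb₄ : W.b₄ = B4) (hb₆ : W.b₆ = B6)
    (hid : isZeroL (subL (smulL cd [B6, 2 * B4, B2, 4]) (addL (smulL cn (mulL G G)) (mulL K H))) = true)
    (hbez : isZeroL (subL (addL (mulL A G) (mulL B H)) [D]) = true) :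
    ∀ r : ℝ, aeval r (ofList H : ℚ[X]) = 0 → 0 < aeval r W.Ψ₂Sq := by
  intro r hr
  rw [eval_ofList_real] at hr
  have H1 := ofList_eq_zero_of_isZeroL (R := ℝ) _ hid
  rw [ofList_subL, ofList_addL, ofList_smulL, ofList_smulL, ofList_mulL, ofList_mulL, sub_eq_zero] at H1
  have H2 := ofList_eq_zero_of_isZeroL (R := ℝ) _ hbez
  rw [ofList_subL, ofList_addL, ofList_mulL, ofList_mulL, ofList_cons, ofList_nil, mul_zero, add_zero, sub_eq_zero] at H2
  -- evaluate both identities at `r`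
  have E1 := congrArg (Polynomial.eval r) H1
  have E2 := congrArg (Polynomial.eval r) H2
  simp only [eval_mul, eval_C, eval_add, hr, mul_zero, add_zero] at E1 E2
  -- `G(r) ≠ 0`
  have hG : (ofList G : ℝ[X]).eval r ≠ 0 := by
    intro h0
    rw [h0, mul_zero] at E2
    exact hD (by exact_mod_cast E2.symm)
  -- the cubic `[B6, 2 B4, B2, 4]` evaluated at `r` is `Ψ₂Sq(r)`
  have E3 : (ofList [B6, 2 * B4, B2, 4] : ℝ[X]).eval r = aeval r W.Ψ₂Sq := by
    rw [EisensteinPrimesKernelIsogenyCertificateType.aeval_Ψ₂Sq_real, hb₂, hb₄, hb₆]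
    simp only [ofList_cons, ofList_nil, eval_add, eval_mul, eval_C, eval_X, mul_zero, add_zero, Int.cast_mul, Int.cast_ofNat,
      Rat.cast_intCast]
    ring
  rw [E3] at E1
  -- `cd · Ψ₂Sq(r) = cn · G(r)²` with `cn, cd > 0`, `G(r) ≠ 0`
  have hpos : 0 < (cn : ℝ) * ((ofList G : ℝ[X]).eval r * (ofList G : ℝ[X]).eval r) :=
    mul_pos (by exact_mod_cast hcn) (mul_self_pos.mpr hG)
  have hcd' : (0 : ℝ) < cd := by exact_mod_cast hcd
  nlinarith [E1, hpos, hcd']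

end Summit.BirchSwinnertonDyer.BirchSwinnertonDyer.Theorems.EisensteinPrimesKernelIsogenyCertificateSquare

end
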